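import Summits.ResolutionOfSingularities.ResolutionOfSingularities.Theorems.WeightedInvariantIota3DropCurveTieLocus
import Summits.ResolutionOfSingularities.ResolutionOfSingularities.Theorems.WeightedInvariantKeyRungThreeOfDropCurveFracTie
import HarnessLib

/-!
# The gap list of `stub_keyRungGrHomLE_three` cut to hD + (D-b³-point) + (D-b³-curve-FRAC-TIE-POINT): the residual of the curve regime PINNED
# to one explicit regular local threefold per tie ideal (door `HypersurfaceCentreConstruction`, stmt-ResolutionOfSingularities-19897)

Helper for `stub_keyRungGrHomLE_three` (def-free, `--supports 19897`).  Assembly of hand -9's tie-locus files (…P3aTieLocus: the order drops at a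
successor over the closed point unless it lies on a tie curve whose tie ideal contains `f`; …P3aTieLocusPin: a `t`-HOMOGENEOUS such successor IS the
generic point `(t⁻¹, z, W)` of its tie curve, a regular local threefold; …Iota3DropCurveTieLocus: the `ι₃ᵗ` / (D-b³) currency for every presentation)
with hand -8's gap list of record `keyRungGrHomLE_three_of_tieDescent_point_curveFracTie` (…KeyRungThreeOfDropCurveFracTie).

* **`Iota3.dropb3_of_point_curveFracTiePoint`** — (D-b³) ⟸ (D-b³-point) + (D-b³-curve-FRAC-TIE-POINT).
* **`Iota3.canonicalGameClauseHomLE_three_of_point_curveFracTiePoint`**, **`keyRungGrHomLE_three_of_tieDescent_point_curveFracTiePoint`**,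
  **`keyRungGrHomLE_three_of_c11_point_curveFracTiePoint`** — THE GAP LISTS OF RECORD: hD ((desc-τ) AS TYPED; typing item) resp. (c11)≤3 +
  (D-b³-point) [`P = 𝔪`: the crux] + **(D-b³-curve-FRAC-TIE-POINT)**: at a CURVE centre `P = (x, y)` of a three-dimensional door position whose
  `S`-presented Abramovich–Quek–Schober germ `(y/1, x/1; r, q; rν)` has fractional slope (`q ≥ 2`), with `b = ⌊r/q⌋ ≥ 1`, `J₃ᵗ = 𝒥((y, x); (b, 1))`,
  `f ∈ 𝒥_{bν}((y,x);(b,1)) ∩ 𝔪^ν ∖ 𝔪^{ν+1}`, for every presentation `(u, w)` of `J₃ᵗ` and every `t`-homogeneous successor `𝔫` of the cobordant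
  blow-up over `𝔪` off the vertex with saturated transform `g`, the `ι₃ᵗ`-drop `ι₃ᵗ(B_𝔫)(g/1) < ι₃ᵗ(S)(f)` is demanded ONLY when
  `𝔫 = (t⁻¹, z, W)` is the generic point of a tie curve `y − λx^b = (t⁻¹)^b W` with `f ∈ 𝒥_{(b+1)ν}((x, y − λx^b, z); (1, b+1, 1))`, or (`b = 1`)
  `𝔫 = (t⁻¹, z, X')`, `x = t⁻¹ X'`, with `f ∈ 𝒥_{2ν}((y, x, z); (1, 2, 1))` — in both cases WITH the datum «`B_𝔫` regular local of Krull dimension `3`,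
  `(t⁻¹, z, W)/1` a regular system of parameters» in hand.  Everything else of (D-b³-curve) (integer slope, tie-free data, successors off the tie
  locus, non-generic points of the tie curves) is settled in the kernel.
What remains there is the `σ`-comparison of CURVE-TIE.md §3 at that one ring (order `ν`, `ε`, `τ` expected to persist; `σ₁` must drop), sub-size (ii),
and — if wanted — the torus step (iii) `B_𝔫 = S'_{𝔫'}(X)`.
[OURS · L1 W4.3 · audit glue; AI work, weaker than expert review; nothing here is a statement of the manuscript under review.]

## References

* D. Abramovich, M. H. Quek, B. Schober, arXiv:2507.01232 (2025), Thm 1.3 (3), Thm 3.5. [AbramovichQuekSchober2025]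
* J. Włodarczyk, *Functorial resolution by torus actions*, arXiv:2203.03090, §2.3.9. [Wlodarczyk2022]
-/

noncomputable section

set_option linter.dupNamespace false -- mandated namespace of this single-conjunct summit

open IsLocalRing Literature.AlgebraicGeometry.Resolution
open Summit.ResolutionOfSingularities.ResolutionOfSingularities.Theorems
open Summit.ResolutionOfSingularities.ResolutionOfSingularities.Theorems.ContactCylinder

namespace Summit.ResolutionOfSingularities.ResolutionOfSingularities.Cruxes.HypersurfaceCentreConstruction.LocalEngine

namespace Iota3

/-- **(D-b³) ⟸ (D-b³-point) + (D-b³-curve-FRAC-TIE-POINT).** [OURS · L1 W4.3 · (D-b³) split] [cite: AbramovichQuekSchober2025, Thm 1.3 (3)]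
[cite: Wlodarczyk2022, §2.3.9] -/
theorem dropb3_of_point_curveFracTiePoint (p : ℕ)
    (hPOINT : ∀ (k₀ : Type) [Field k₀] [CharP k₀ p] [PerfectField k₀]
      (S : Type) [CommRing S] [Algebra k₀ S] [Algebra.EssFiniteType k₀ S] [IsRegularLocalRing S]
      (f : S), ringKrullDim S = 3 → f ≠ 0 → f ∈ (maximalIdeal S) ^ 2 →
      ∀ (P : Ideal S) [P.IsPrime], IsRegularLocalRing (S ⧸ P) → f ∈ P →
        topStratum iotaOrdEpsTau S f = {𝔮 | P ≤ 𝔮.asIdeal} → ¬ ringKrullDim (Localization.AtPrime P) ≤ 1 →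
        P = maximalIdeal S →
        ∀ (n : ℕ) (u : Fin n → S) (w : Fin n → ℕ),
          Ideal.span (Set.range u) = maximalIdeal S → (maximalIdeal S).spanFinrank = n → (∃ i, 0 < w i) →
          Ideal.span {x | ∃ i, 0 < w i ∧ x = u i} = P →
          (∀ m : ℕ, weightedMonomialIdeal u w m = jFlatT S f m) →
          ∀ (𝔫 : Ideal (cobordantAlgebra' u w)) [𝔫.IsPrime], IsTHomogeneous u w 𝔫 → cobordantT' u w ∈ 𝔫 →
            (maximalIdeal S).map (algebraMap S (cobordantAlgebra' u w)) ≤ 𝔫 →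
            ¬ extReesAlgebra.vertexIdeal (weightedMonomialIdeal u w) ≤ 𝔫 →
            ∀ (a : ℕ) (g : cobordantAlgebra' u w), algebraMap S (cobordantAlgebra' u w) f = cobordantT' u w ^ a * g →
              ¬ cobordantT' u w ∣ g →
              algebraMap (cobordantAlgebra' u w) (Localization.AtPrime 𝔫) g ∈ maximalIdeal (Localization.AtPrime 𝔫) ^ 2 →
              iotaFlatT (Localization.AtPrime 𝔫) (algebraMap (cobordantAlgebra' u w) (Localization.AtPrime 𝔫) g) <
                iotaFlatT S f)
    (hCURVEFRACTIEPOINT : ∀ (k₀ : Type) [Field k₀] [CharP k₀ p] [PerfectField k₀]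
      (S : Type) [CommRing S] [Algebra k₀ S] [Algebra.EssFiniteType k₀ S] [IsRegularLocalRing S]
      (f : S), ringKrullDim S = 3 → f ≠ 0 → f ∈ (maximalIdeal S) ^ 2 →
      ∀ (P : Ideal S) [P.IsPrime], IsRegularLocalRing (S ⧸ P) → f ∈ P →
        topStratum iotaOrdEpsTau S f = {𝔮 | P ≤ 𝔮.asIdeal} → ¬ ringKrullDim (Localization.AtPrime P) ≤ 1 →
        P ≠ maximalIdeal S →
        ∀ (x y z : S) (q r ν : ℕ) (_ : (Ideal.span ({x, y} : Set S)).IsPrime), Ideal.span {x, y, z} = maximalIdeal S →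
          P = Ideal.span {x, y} → 2 ≤ q → q ≤ r → 1 ≤ ν → f ∈ maximalIdeal S ^ ν → f ∉ maximalIdeal S ^ (ν + 1) →
          IsLexMaxWeightedCentreGerm (Localization.AtPrime (Ideal.span ({x, y} : Set S)))
            (Ideal.span {algebraMap S (Localization.AtPrime (Ideal.span ({x, y} : Set S))) f})
            ![algebraMap S (Localization.AtPrime (Ideal.span ({x, y} : Set S))) y,
              algebraMap S (Localization.AtPrime (Ideal.span ({x, y} : Set S))) x] ![r, q] (r * ν) →
          1 ≤ r / q → f ∈ weightedMonomialIdeal ![y, x] ![r / q, 1] (r / q * ν) →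
          (∀ m : ℕ, jFlatT S f m = weightedMonomialIdeal ![y, x] ![r / q, 1] m) →
        ∀ (n : ℕ) (u : Fin n → S) (w : Fin n → ℕ),
          Ideal.span (Set.range u) = maximalIdeal S → (maximalIdeal S).spanFinrank = n → (∃ i, 0 < w i) →
          Ideal.span {x | ∃ i, 0 < w i ∧ x = u i} = P →
          (∀ m : ℕ, weightedMonomialIdeal u w m = jFlatT S f m) →
          ∀ (𝔫 : Ideal (cobordantAlgebra' u w)) [𝔫.IsPrime], IsTHomogeneous u w 𝔫 → cobordantT' u w ∈ 𝔫 →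
            (maximalIdeal S).map (algebraMap S (cobordantAlgebra' u w)) ≤ 𝔫 →
            ¬ extReesAlgebra.vertexIdeal (weightedMonomialIdeal u w) ≤ 𝔫 →
            ∀ (a : ℕ) (g : cobordantAlgebra' u w), algebraMap S (cobordantAlgebra' u w) f = cobordantT' u w ^ a * g →
              ¬ cobordantT' u w ∣ g →
              algebraMap (cobordantAlgebra' u w) (Localization.AtPrime 𝔫) g ∈ maximalIdeal (Localization.AtPrime 𝔫) ^ 2 →
              ((∃ lam : S, f ∈ weightedMonomialIdeal ![x, y - lam * x ^ (r / q), z] ![1, r / q + 1, 1] ((r / q + 1) * ν) ∧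
                  ∃ W : cobordantAlgebra' u w,
                    algebraMap S (cobordantAlgebra' u w) (y - lam * x ^ (r / q)) = cobordantT' u w ^ (r / q) * W ∧
                    𝔫 = Ideal.span {cobordantT' u w, algebraMap S (cobordantAlgebra' u w) z, W} ∧
                    IsRegularLocalRing (Localization.AtPrime 𝔫) ∧ ringKrullDim (Localization.AtPrime 𝔫) = (3 : ℕ) ∧
                    Ideal.span {algebraMap _ (Localization.AtPrime 𝔫) (cobordantT' u w),
                      algebraMap _ (Localization.AtPrime 𝔫) (algebraMap S (cobordantAlgebra' u w) z),
                      algebraMap _ (Localization.AtPrime 𝔫) W} = maximalIdeal (Localization.AtPrime 𝔫)) ∨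
                (r / q = 1 ∧ f ∈ weightedMonomialIdeal ![y, x, z] ![1, 2, 1] (2 * ν) ∧
                  ∃ X' : cobordantAlgebra' u w, algebraMap S (cobordantAlgebra' u w) x = cobordantT' u w * X' ∧
                    𝔫 = Ideal.span {cobordantT' u w, algebraMap S (cobordantAlgebra' u w) z, X'} ∧
                    IsRegularLocalRing (Localization.AtPrime 𝔫) ∧ ringKrullDim (Localization.AtPrime 𝔫) = (3 : ℕ) ∧
                    Ideal.span {algebraMap _ (Localization.AtPrime 𝔫) (cobordantT' u w),
                      algebraMap _ (Localization.AtPrime 𝔫) (algebraMap S (cobordantAlgebra' u w) z),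
                      algebraMap _ (Localization.AtPrime 𝔫) X'} = maximalIdeal (Localization.AtPrime 𝔫))) →
              iotaFlatT (Localization.AtPrime 𝔫) (algebraMap (cobordantAlgebra' u w) (Localization.AtPrime 𝔫) g) <
                iotaFlatT S f) :
    ∀ (k₀ : Type) [Field k₀] [CharP k₀ p] [PerfectField k₀]
      (S : Type) [CommRing S] [Algebra k₀ S] [Algebra.EssFiniteType k₀ S] [IsRegularLocalRing S]
      (f : S), ringKrullDim S = 3 → f ≠ 0 → f ∈ (maximalIdeal S) ^ 2 →
      ∀ (P : Ideal S) [P.IsPrime], IsRegularLocalRing (S ⧸ P) → f ∈ P →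
        topStratum iotaOrdEpsTau S f = {𝔮 | P ≤ 𝔮.asIdeal} → ¬ ringKrullDim (Localization.AtPrime P) ≤ 1 →
        ∀ (n : ℕ) (u : Fin n → S) (w : Fin n → ℕ),
          Ideal.span (Set.range u) = maximalIdeal S → (maximalIdeal S).spanFinrank = n → (∃ i, 0 < w i) →
          Ideal.span {x | ∃ i, 0 < w i ∧ x = u i} = P →
          (∀ m : ℕ, weightedMonomialIdeal u w m = jFlatT S f m) →
          ∀ (𝔫 : Ideal (cobordantAlgebra' u w)) [𝔫.IsPrime], IsTHomogeneous u w 𝔫 → cobordantT' u w ∈ 𝔫 →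
            (maximalIdeal S).map (algebraMap S (cobordantAlgebra' u w)) ≤ 𝔫 →
            ¬ extReesAlgebra.vertexIdeal (weightedMonomialIdeal u w) ≤ 𝔫 →
            ∀ (a : ℕ) (g : cobordantAlgebra' u w), algebraMap S (cobordantAlgebra' u w) f = cobordantT' u w ^ a * g →
              ¬ cobordantT' u w ∣ g →
              algebraMap (cobordantAlgebra' u w) (Localization.AtPrime 𝔫) g ∈ maximalIdeal (Localization.AtPrime 𝔫) ^ 2 →
              iotaFlatT (Localization.AtPrime 𝔫) (algebraMap (cobordantAlgebra' u w) (Localization.AtPrime 𝔫) g) <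
                iotaFlatT S f :=
  dropb3_of_point_curveFracTie p hPOINT
    fun k₀ _ _ _ S _ _ _ _ f hd hf0 hf2 P _ hreg hfP hE hP1 hPm x y z q r ν hPxy hxyz hPeq hq2 hqr hν1 hfν hfν1 hlex hb1 hadm hJ
      _ n u w h1 h2 h3 h4 h5 => by
    classical
    have hd3 : ringKrullDim S = (3 : ℕ) := by rw [hd]; rfl
    have hrk : (maximalIdeal S).spanFinrank = 3 := by
      have h := IsRegularLocalRing.spanFinrank_maximalIdeal (R := S)
      rw [hd3] at h
      exact_mod_cast h
    haveI hPyx : (Ideal.span (Set.range ![y, x])).IsPrime := by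
      rw [show Set.range ![y, x] = {y, x} by
        rw [Matrix.range_cons, Matrix.range_cons, Matrix.range_empty, Set.union_empty, Set.singleton_union], Ideal.span_pair_comm,
        ← hPeq]
      infer_instance
    have hyxz : Ideal.span (Set.range ![y, x, z]) = maximalIdeal S := by rw [range_three, Set.insert_comm]; exact hxyz
    intro 𝔫 _ hhom hT hM hV a g hfg hTg hg2
    rcases dropb3_curve_or_tiePoint hyxz hrk Nat.one_pos hb1 (Nat.coprime_one_right _) hν1 hfν hfν1 hadm u w
        (fun m => by rw [h5 m, hJ m]) 𝔫 hhom hT hM hV a g hfg hTg hg2 with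
        h | ⟨lam, -, hft, W, hW, h𝔫, hR⟩ | ⟨-, hb, hft, X', hX', h𝔫, hR⟩
    · exact h
    · exact hCURVEFRACTIEPOINT k₀ S f hd hf0 hf2 P hreg hfP hE hP1 hPm x y z q r ν hPxy hxyz hPeq hq2 hqr hν1 hfν hfν1 hlex hb1
        hadm hJ n u w h1 h2 h3 h4 h5 𝔫 hhom hT hM hV a g hfg hTg hg2 (Or.inl ⟨lam, hft, W, hW, h𝔫, hR⟩)
    · exact hCURVEFRACTIEPOINT k₀ S f hd hf0 hf2 P hreg hfP hE hP1 hPm x y z q r ν hPxy hxyz hPeq hq2 hqr hν1 hfν hfν1 hlex hb1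
        hadm hJ n u w h1 h2 h3 h4 h5 𝔫 hhom hT hM hV a g hfg hTg hg2 (Or.inr ⟨hb, hft, X', by rw [hX', pow_one], h𝔫, hR⟩)

/-- **hgame ⟸ (D-b³-point) + (D-b³-curve-FRAC-TIE-POINT).** [OURS · L1 W4.3 · audit glue] -/
theorem canonicalGameClauseHomLE_three_of_point_curveFracTiePoint (p : ℕ)
    (hPOINT : ∀ (k₀ : Type) [Field k₀] [CharP k₀ p] [PerfectField k₀]
      (S : Type) [CommRing S] [Algebra k₀ S] [Algebra.EssFiniteType k₀ S] [IsRegularLocalRing S]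
      (f : S), ringKrullDim S = 3 → f ≠ 0 → f ∈ (maximalIdeal S) ^ 2 →
      ∀ (P : Ideal S) [P.IsPrime], IsRegularLocalRing (S ⧸ P) → f ∈ P →
        topStratum iotaOrdEpsTau S f = {𝔮 | P ≤ 𝔮.asIdeal} → ¬ ringKrullDim (Localization.AtPrime P) ≤ 1 →
        P = maximalIdeal S →
        ∀ (n : ℕ) (u : Fin n → S) (w : Fin n → ℕ),
          Ideal.span (Set.range u) = maximalIdeal S → (maximalIdeal S).spanFinrank = n → (∃ i, 0 < w i) →
          Ideal.span {x | ∃ i, 0 < w i ∧ x = u i} = P →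
          (∀ m : ℕ, weightedMonomialIdeal u w m = jFlatT S f m) →
          ∀ (𝔫 : Ideal (cobordantAlgebra' u w)) [𝔫.IsPrime], IsTHomogeneous u w 𝔫 → cobordantT' u w ∈ 𝔫 →
            (maximalIdeal S).map (algebraMap S (cobordantAlgebra' u w)) ≤ 𝔫 →
            ¬ extReesAlgebra.vertexIdeal (weightedMonomialIdeal u w) ≤ 𝔫 →
            ∀ (a : ℕ) (g : cobordantAlgebra' u w), algebraMap S (cobordantAlgebra' u w) f = cobordantT' u w ^ a * g →
              ¬ cobordantT' u w ∣ g →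
              algebraMap (cobordantAlgebra' u w) (Localization.AtPrime 𝔫) g ∈ maximalIdeal (Localization.AtPrime 𝔫) ^ 2 →
              iotaFlatT (Localization.AtPrime 𝔫) (algebraMap (cobordantAlgebra' u w) (Localization.AtPrime 𝔫) g) <
                iotaFlatT S f)
    (hCURVEFRACTIEPOINT : ∀ (k₀ : Type) [Field k₀] [CharP k₀ p] [PerfectField k₀]
      (S : Type) [CommRing S] [Algebra k₀ S] [Algebra.EssFiniteType k₀ S] [IsRegularLocalRing S]
      (f : S), ringKrullDim S = 3 → f ≠ 0 → f ∈ (maximalIdeal S) ^ 2 →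
      ∀ (P : Ideal S) [P.IsPrime], IsRegularLocalRing (S ⧸ P) → f ∈ P →
        topStratum iotaOrdEpsTau S f = {𝔮 | P ≤ 𝔮.asIdeal} → ¬ ringKrullDim (Localization.AtPrime P) ≤ 1 →
        P ≠ maximalIdeal S →
        ∀ (x y z : S) (q r ν : ℕ) (_ : (Ideal.span ({x, y} : Set S)).IsPrime), Ideal.span {x, y, z} = maximalIdeal S →
          P = Ideal.span {x, y} → 2 ≤ q → q ≤ r → 1 ≤ ν → f ∈ maximalIdeal S ^ ν → f ∉ maximalIdeal S ^ (ν + 1) →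
          IsLexMaxWeightedCentreGerm (Localization.AtPrime (Ideal.span ({x, y} : Set S)))
            (Ideal.span {algebraMap S (Localization.AtPrime (Ideal.span ({x, y} : Set S))) f})
            ![algebraMap S (Localization.AtPrime (Ideal.span ({x, y} : Set S))) y,
              algebraMap S (Localization.AtPrime (Ideal.span ({x, y} : Set S))) x] ![r, q] (r * ν) →
          1 ≤ r / q → f ∈ weightedMonomialIdeal ![y, x] ![r / q, 1] (r / q * ν) →
          (∀ m : ℕ, jFlatT S f m = weightedMonomialIdeal ![y, x] ![r / q, 1] m) →
        ∀ (n : ℕ) (u : Fin n → S) (w : Fin n → ℕ),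
          Ideal.span (Set.range u) = maximalIdeal S → (maximalIdeal S).spanFinrank = n → (∃ i, 0 < w i) →
          Ideal.span {x | ∃ i, 0 < w i ∧ x = u i} = P →
          (∀ m : ℕ, weightedMonomialIdeal u w m = jFlatT S f m) →
          ∀ (𝔫 : Ideal (cobordantAlgebra' u w)) [𝔫.IsPrime], IsTHomogeneous u w 𝔫 → cobordantT' u w ∈ 𝔫 →
            (maximalIdeal S).map (algebraMap S (cobordantAlgebra' u w)) ≤ 𝔫 →
            ¬ extReesAlgebra.vertexIdeal (weightedMonomialIdeal u w) ≤ 𝔫 →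
            ∀ (a : ℕ) (g : cobordantAlgebra' u w), algebraMap S (cobordantAlgebra' u w) f = cobordantT' u w ^ a * g →
              ¬ cobordantT' u w ∣ g →
              algebraMap (cobordantAlgebra' u w) (Localization.AtPrime 𝔫) g ∈ maximalIdeal (Localization.AtPrime 𝔫) ^ 2 →
              ((∃ lam : S, f ∈ weightedMonomialIdeal ![x, y - lam * x ^ (r / q), z] ![1, r / q + 1, 1] ((r / q + 1) * ν) ∧
                  ∃ W : cobordantAlgebra' u w,
                    algebraMap S (cobordantAlgebra' u w) (y - lam * x ^ (r / q)) = cobordantT' u w ^ (r / q) * W ∧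
                    𝔫 = Ideal.span {cobordantT' u w, algebraMap S (cobordantAlgebra' u w) z, W} ∧
                    IsRegularLocalRing (Localization.AtPrime 𝔫) ∧ ringKrullDim (Localization.AtPrime 𝔫) = (3 : ℕ) ∧
                    Ideal.span {algebraMap _ (Localization.AtPrime 𝔫) (cobordantT' u w),
                      algebraMap _ (Localization.AtPrime 𝔫) (algebraMap S (cobordantAlgebra' u w) z),
                      algebraMap _ (Localization.AtPrime 𝔫) W} = maximalIdeal (Localization.AtPrime 𝔫)) ∨
                (r / q = 1 ∧ f ∈ weightedMonomialIdeal ![y, x, z] ![1, 2, 1] (2 * ν) ∧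
                  ∃ X' : cobordantAlgebra' u w, algebraMap S (cobordantAlgebra' u w) x = cobordantT' u w * X' ∧
                    𝔫 = Ideal.span {cobordantT' u w, algebraMap S (cobordantAlgebra' u w) z, X'} ∧
                    IsRegularLocalRing (Localization.AtPrime 𝔫) ∧ ringKrullDim (Localization.AtPrime 𝔫) = (3 : ℕ) ∧
                    Ideal.span {algebraMap _ (Localization.AtPrime 𝔫) (cobordantT' u w),
                      algebraMap _ (Localization.AtPrime 𝔫) (algebraMap S (cobordantAlgebra' u w) z),
                      algebraMap _ (Localization.AtPrime 𝔫) X'} = maximalIdeal (Localization.AtPrime 𝔫))) →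
              iotaFlatT (Localization.AtPrime 𝔫) (algebraMap (cobordantAlgebra' u w) (Localization.AtPrime 𝔫) g) <
                iotaFlatT S f) :
    CanonicalGameClauseHomLE 3 p iotaFlatT jFlatT :=
  canonicalGameClauseHomLE_three_of_dropb3 p (dropb3_of_point_curveFracTiePoint p hPOINT hCURVEFRACTIEPOINT)

end Iota3

open Iota3

/-- **GAP LIST OF RECORD for `stub_keyRungGrHomLE_three` — hD + (D-b³-point) + (D-b³-curve-FRAC-TIE-POINT)** (module docstring).
[OURS · L1 W4.3 · audit glue] -/
theorem keyRungGrHomLE_three_of_tieDescent_point_curveFracTiePoint (p : ℕ)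
    (hD : ∀ (T T' : Type) [CommRing T] [IsRegularLocalRing T] [CommRing T'] [IsRegularLocalRing T'] [Algebra T T']
      [IsLocalHom (algebraMap T T')] [Algebra.FormallySmooth T T'] [Algebra.EssFiniteType T T'] (g : T),
      ringKrullDim T' ≤ 3 → IsTiePosition T' (algebraMap T T' g) → IsTiePosition T g)
    (hPOINT : ∀ (k₀ : Type) [Field k₀] [CharP k₀ p] [PerfectField k₀]
      (S : Type) [CommRing S] [Algebra k₀ S] [Algebra.EssFiniteType k₀ S] [IsRegularLocalRing S]
      (f : S), ringKrullDim S = 3 → f ≠ 0 → f ∈ (maximalIdeal S) ^ 2 →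
      ∀ (P : Ideal S) [P.IsPrime], IsRegularLocalRing (S ⧸ P) → f ∈ P →
        topStratum iotaOrdEpsTau S f = {𝔮 | P ≤ 𝔮.asIdeal} → ¬ ringKrullDim (Localization.AtPrime P) ≤ 1 →
        P = maximalIdeal S →
        ∀ (n : ℕ) (u : Fin n → S) (w : Fin n → ℕ),
          Ideal.span (Set.range u) = maximalIdeal S → (maximalIdeal S).spanFinrank = n → (∃ i, 0 < w i) →
          Ideal.span {x | ∃ i, 0 < w i ∧ x = u i} = P →
          (∀ m : ℕ, weightedMonomialIdeal u w m = jFlatT S f m) →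
          ∀ (𝔫 : Ideal (cobordantAlgebra' u w)) [𝔫.IsPrime], IsTHomogeneous u w 𝔫 → cobordantT' u w ∈ 𝔫 →
            (maximalIdeal S).map (algebraMap S (cobordantAlgebra' u w)) ≤ 𝔫 →
            ¬ extReesAlgebra.vertexIdeal (weightedMonomialIdeal u w) ≤ 𝔫 →
            ∀ (a : ℕ) (g : cobordantAlgebra' u w), algebraMap S (cobordantAlgebra' u w) f = cobordantT' u w ^ a * g →
              ¬ cobordantT' u w ∣ g →
              algebraMap (cobordantAlgebra' u w) (Localization.AtPrime 𝔫) g ∈ maximalIdeal (Localization.AtPrime 𝔫) ^ 2 →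
              iotaFlatT (Localization.AtPrime 𝔫) (algebraMap (cobordantAlgebra' u w) (Localization.AtPrime 𝔫) g) <
                iotaFlatT S f)
    (hCURVEFRACTIEPOINT : ∀ (k₀ : Type) [Field k₀] [CharP k₀ p] [PerfectField k₀]
      (S : Type) [CommRing S] [Algebra k₀ S] [Algebra.EssFiniteType k₀ S] [IsRegularLocalRing S]
      (f : S), ringKrullDim S = 3 → f ≠ 0 → f ∈ (maximalIdeal S) ^ 2 →
      ∀ (P : Ideal S) [P.IsPrime], IsRegularLocalRing (S ⧸ P) → f ∈ P →
        topStratum iotaOrdEpsTau S f = {𝔮 | P ≤ 𝔮.asIdeal} → ¬ ringKrullDim (Localization.AtPrime P) ≤ 1 →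
        P ≠ maximalIdeal S →
        ∀ (x y z : S) (q r ν : ℕ) (_ : (Ideal.span ({x, y} : Set S)).IsPrime), Ideal.span {x, y, z} = maximalIdeal S →
          P = Ideal.span {x, y} → 2 ≤ q → q ≤ r → 1 ≤ ν → f ∈ maximalIdeal S ^ ν → f ∉ maximalIdeal S ^ (ν + 1) →
          IsLexMaxWeightedCentreGerm (Localization.AtPrime (Ideal.span ({x, y} : Set S)))
            (Ideal.span {algebraMap S (Localization.AtPrime (Ideal.span ({x, y} : Set S))) f})
            ![algebraMap S (Localization.AtPrime (Ideal.span ({x, y} : Set S))) y,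
              algebraMap S (Localization.AtPrime (Ideal.span ({x, y} : Set S))) x] ![r, q] (r * ν) →
          1 ≤ r / q → f ∈ weightedMonomialIdeal ![y, x] ![r / q, 1] (r / q * ν) →
          (∀ m : ℕ, jFlatT S f m = weightedMonomialIdeal ![y, x] ![r / q, 1] m) →
        ∀ (n : ℕ) (u : Fin n → S) (w : Fin n → ℕ),
          Ideal.span (Set.range u) = maximalIdeal S → (maximalIdeal S).spanFinrank = n → (∃ i, 0 < w i) →
          Ideal.span {x | ∃ i, 0 < w i ∧ x = u i} = P →
          (∀ m : ℕ, weightedMonomialIdeal u w m = jFlatT S f m) →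
          ∀ (𝔫 : Ideal (cobordantAlgebra' u w)) [𝔫.IsPrime], IsTHomogeneous u w 𝔫 → cobordantT' u w ∈ 𝔫 →
            (maximalIdeal S).map (algebraMap S (cobordantAlgebra' u w)) ≤ 𝔫 →
            ¬ extReesAlgebra.vertexIdeal (weightedMonomialIdeal u w) ≤ 𝔫 →
            ∀ (a : ℕ) (g : cobordantAlgebra' u w), algebraMap S (cobordantAlgebra' u w) f = cobordantT' u w ^ a * g →
              ¬ cobordantT' u w ∣ g →
              algebraMap (cobordantAlgebra' u w) (Localization.AtPrime 𝔫) g ∈ maximalIdeal (Localization.AtPrime 𝔫) ^ 2 →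
              ((∃ lam : S, f ∈ weightedMonomialIdeal ![x, y - lam * x ^ (r / q), z] ![1, r / q + 1, 1] ((r / q + 1) * ν) ∧
                  ∃ W : cobordantAlgebra' u w,
                    algebraMap S (cobordantAlgebra' u w) (y - lam * x ^ (r / q)) = cobordantT' u w ^ (r / q) * W ∧
                    𝔫 = Ideal.span {cobordantT' u w, algebraMap S (cobordantAlgebra' u w) z, W} ∧
                    IsRegularLocalRing (Localization.AtPrime 𝔫) ∧ ringKrullDim (Localization.AtPrime 𝔫) = (3 : ℕ) ∧
                    Ideal.span {algebraMap _ (Localization.AtPrime 𝔫) (cobordantT' u w),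
                      algebraMap _ (Localization.AtPrime 𝔫) (algebraMap S (cobordantAlgebra' u w) z),
                      algebraMap _ (Localization.AtPrime 𝔫) W} = maximalIdeal (Localization.AtPrime 𝔫)) ∨
                (r / q = 1 ∧ f ∈ weightedMonomialIdeal ![y, x, z] ![1, 2, 1] (2 * ν) ∧
                  ∃ X' : cobordantAlgebra' u w, algebraMap S (cobordantAlgebra' u w) x = cobordantT' u w * X' ∧
                    𝔫 = Ideal.span {cobordantT' u w, algebraMap S (cobordantAlgebra' u w) z, X'} ∧
                    IsRegularLocalRing (Localization.AtPrime 𝔫) ∧ ringKrullDim (Localization.AtPrime 𝔫) = (3 : ℕ) ∧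
                    Ideal.span {algebraMap _ (Localization.AtPrime 𝔫) (cobordantT' u w),
                      algebraMap _ (Localization.AtPrime 𝔫) (algebraMap S (cobordantAlgebra' u w) z),
                      algebraMap _ (Localization.AtPrime 𝔫) X'} = maximalIdeal (Localization.AtPrime 𝔫))) →
              iotaFlatT (Localization.AtPrime 𝔫) (algebraMap (cobordantAlgebra' u w) (Localization.AtPrime 𝔫) g) <
                iotaFlatT S f) :
    KeyRungGrHomLE 3 p :=
  keyRungGrHomLE_three_of_game p hD (canonicalGameClauseHomLE_three_of_point_curveFracTiePoint p hPOINT hCURVEFRACTIEPOINT)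

/-- **GAP LIST OF RECORD, (c11)-form — (c11)≤3 + (D-b³-point) + (D-b³-curve-FRAC-TIE-POINT).** [OURS · L1 W4.3 · audit glue] -/
theorem keyRungGrHomLE_three_of_c11_point_curveFracTiePoint (p : ℕ) (hc11 : IotaJEssSmoothCompatibleLE 3 iotaFlatT jFlatT)
    (hPOINT : ∀ (k₀ : Type) [Field k₀] [CharP k₀ p] [PerfectField k₀]
      (S : Type) [CommRing S] [Algebra k₀ S] [Algebra.EssFiniteType k₀ S] [IsRegularLocalRing S]
      (f : S), ringKrullDim S = 3 → f ≠ 0 → f ∈ (maximalIdeal S) ^ 2 →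
      ∀ (P : Ideal S) [P.IsPrime], IsRegularLocalRing (S ⧸ P) → f ∈ P →
        topStratum iotaOrdEpsTau S f = {𝔮 | P ≤ 𝔮.asIdeal} → ¬ ringKrullDim (Localization.AtPrime P) ≤ 1 →
        P = maximalIdeal S →
        ∀ (n : ℕ) (u : Fin n → S) (w : Fin n → ℕ),
          Ideal.span (Set.range u) = maximalIdeal S → (maximalIdeal S).spanFinrank = n → (∃ i, 0 < w i) →
          Ideal.span {x | ∃ i, 0 < w i ∧ x = u i} = P →
          (∀ m : ℕ, weightedMonomialIdeal u w m = jFlatT S f m) →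
          ∀ (𝔫 : Ideal (cobordantAlgebra' u w)) [𝔫.IsPrime], IsTHomogeneous u w 𝔫 → cobordantT' u w ∈ 𝔫 →
            (maximalIdeal S).map (algebraMap S (cobordantAlgebra' u w)) ≤ 𝔫 →
            ¬ extReesAlgebra.vertexIdeal (weightedMonomialIdeal u w) ≤ 𝔫 →
            ∀ (a : ℕ) (g : cobordantAlgebra' u w), algebraMap S (cobordantAlgebra' u w) f = cobordantT' u w ^ a * g →
              ¬ cobordantT' u w ∣ g →
              algebraMap (cobordantAlgebra' u w) (Localization.AtPrime 𝔫) g ∈ maximalIdeal (Localization.AtPrime 𝔫) ^ 2 →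
              iotaFlatT (Localization.AtPrime 𝔫) (algebraMap (cobordantAlgebra' u w) (Localization.AtPrime 𝔫) g) <
                iotaFlatT S f)
    (hCURVEFRACTIEPOINT : ∀ (k₀ : Type) [Field k₀] [CharP k₀ p] [PerfectField k₀]
      (S : Type) [CommRing S] [Algebra k₀ S] [Algebra.EssFiniteType k₀ S] [IsRegularLocalRing S]
      (f : S), ringKrullDim S = 3 → f ≠ 0 → f ∈ (maximalIdeal S) ^ 2 →
      ∀ (P : Ideal S) [P.IsPrime], IsRegularLocalRing (S ⧸ P) → f ∈ P →
        topStratum iotaOrdEpsTau S f = {𝔮 | P ≤ 𝔮.asIdeal} → ¬ ringKrullDim (Localization.AtPrime P) ≤ 1 →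
        P ≠ maximalIdeal S →
        ∀ (x y z : S) (q r ν : ℕ) (_ : (Ideal.span ({x, y} : Set S)).IsPrime), Ideal.span {x, y, z} = maximalIdeal S →
          P = Ideal.span {x, y} → 2 ≤ q → q ≤ r → 1 ≤ ν → f ∈ maximalIdeal S ^ ν → f ∉ maximalIdeal S ^ (ν + 1) →
          IsLexMaxWeightedCentreGerm (Localization.AtPrime (Ideal.span ({x, y} : Set S)))
            (Ideal.span {algebraMap S (Localization.AtPrime (Ideal.span ({x, y} : Set S))) f})
            ![algebraMap S (Localization.AtPrime (Ideal.span ({x, y} : Set S))) y,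
              algebraMap S (Localization.AtPrime (Ideal.span ({x, y} : Set S))) x] ![r, q] (r * ν) →
          1 ≤ r / q → f ∈ weightedMonomialIdeal ![y, x] ![r / q, 1] (r / q * ν) →
          (∀ m : ℕ, jFlatT S f m = weightedMonomialIdeal ![y, x] ![r / q, 1] m) →
        ∀ (n : ℕ) (u : Fin n → S) (w : Fin n → ℕ),
          Ideal.span (Set.range u) = maximalIdeal S → (maximalIdeal S).spanFinrank = n → (∃ i, 0 < w i) →
          Ideal.span {x | ∃ i, 0 < w i ∧ x = u i} = P →
          (∀ m : ℕ, weightedMonomialIdeal u w m = jFlatT S f m) →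
          ∀ (𝔫 : Ideal (cobordantAlgebra' u w)) [𝔫.IsPrime], IsTHomogeneous u w 𝔫 → cobordantT' u w ∈ 𝔫 →
            (maximalIdeal S).map (algebraMap S (cobordantAlgebra' u w)) ≤ 𝔫 →
            ¬ extReesAlgebra.vertexIdeal (weightedMonomialIdeal u w) ≤ 𝔫 →
            ∀ (a : ℕ) (g : cobordantAlgebra' u w), algebraMap S (cobordantAlgebra' u w) f = cobordantT' u w ^ a * g →
              ¬ cobordantT' u w ∣ g →
              algebraMap (cobordantAlgebra' u w) (Localization.AtPrime 𝔫) g ∈ maximalIdeal (Localization.AtPrime 𝔫) ^ 2 →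
              ((∃ lam : S, f ∈ weightedMonomialIdeal ![x, y - lam * x ^ (r / q), z] ![1, r / q + 1, 1] ((r / q + 1) * ν) ∧
                  ∃ W : cobordantAlgebra' u w,
                    algebraMap S (cobordantAlgebra' u w) (y - lam * x ^ (r / q)) = cobordantT' u w ^ (r / q) * W ∧
                    𝔫 = Ideal.span {cobordantT' u w, algebraMap S (cobordantAlgebra' u w) z, W} ∧
                    IsRegularLocalRing (Localization.AtPrime 𝔫) ∧ ringKrullDim (Localization.AtPrime 𝔫) = (3 : ℕ) ∧
                    Ideal.span {algebraMap _ (Localization.AtPrime 𝔫) (cobordantT' u w),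
                      algebraMap _ (Localization.AtPrime 𝔫) (algebraMap S (cobordantAlgebra' u w) z),
                      algebraMap _ (Localization.AtPrime 𝔫) W} = maximalIdeal (Localization.AtPrime 𝔫)) ∨
                (r / q = 1 ∧ f ∈ weightedMonomialIdeal ![y, x, z] ![1, 2, 1] (2 * ν) ∧
                  ∃ X' : cobordantAlgebra' u w, algebraMap S (cobordantAlgebra' u w) x = cobordantT' u w * X' ∧
                    𝔫 = Ideal.span {cobordantT' u w, algebraMap S (cobordantAlgebra' u w) z, X'} ∧
                    IsRegularLocalRing (Localization.AtPrime 𝔫) ∧ ringKrullDim (Localization.AtPrime 𝔫) = (3 : ℕ) ∧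
                    Ideal.span {algebraMap _ (Localization.AtPrime 𝔫) (cobordantT' u w),
                      algebraMap _ (Localization.AtPrime 𝔫) (algebraMap S (cobordantAlgebra' u w) z),
                      algebraMap _ (Localization.AtPrime 𝔫) X'} = maximalIdeal (Localization.AtPrime 𝔫))) →
              iotaFlatT (Localization.AtPrime 𝔫) (algebraMap (cobordantAlgebra' u w) (Localization.AtPrime 𝔫) g) <
                iotaFlatT S f) :
    KeyRungGrHomLE 3 p :=
  keyRungGrHomLE_three_of_c11_game p hc11 (canonicalGameClauseHomLE_three_of_point_curveFracTiePoint p hPOINT hCURVEFRACTIEPOINT)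

end Summit.ResolutionOfSingularities.ResolutionOfSingularities.Cruxes.HypersurfaceCentreConstruction.LocalEngine

end
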